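import Summits.CriticalPhenomena.PercolationContinuityZ3.Theorems.PercNearOneGluingNoHeavyQuantLawDecFlowsDecomposition
import Summits.CriticalPhenomena.PercolationContinuityZ3.Theorems.PercNearOneGluingNoHeavyQuantHeavyShift
import HarnessLib

/-!
# QUANT lane R8, T-DEC: the PAIR-WEIGHT (transport) form of a HEAVY decomposition — any table of pair weights and gates that ships
# the low atoms exactly and loads the high atoms by at most their mass IS a heavy decomposition (prim-quant-census-2 gen 81)

builds on p205010 (kernel theorem, internal audit signed; external expert review pending)

Support file (`--supports stmt-CriticalPhenomena-4575`), QUANT lane census seat prim-quant-census-2 (gen 81); memo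
`run/shared/lean/prim/quant/prim-quant-census-2-g81/AFL-G81.md` §3 item 14.  Theorems only, standard axioms, no sorries, no definitions.

A HEAVY decomposition of a law `μ` on `{0..M}` at floor `x`, target `T` (inline `∃`, as consumed by `decAtT_of_heavy`, `heavy_shift_full`,
`heavy_shift_partial` of `…QuantHeavyShift`) is a mixture of pairs `{lo,hi;γ}` with `x ≤ γ`, credit `2lo + (hi−lo)γ ≥ T`, and self-sufficient
points.  Every such decomposition the lane has built (`heavy_of_zeroLow`, `heavy_of_reflection`, the four/five-atom regime lemmas of
census-2 g80) is a TRANSPORT of the low atoms (`2l < T`) into the high ones along pairs.  This file states that normal form once, so that a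
width-`n` blob lemma reduces to an explicit table and its capacity inequalities (memo §5):

* **`heavy_of_pairWeights`** — law `μ` on `{0..M}` (vanishing above `M`, mass `1`), floor `0 ≤ x ≤ 1`, target `T`; pair WEIGHTS `w l h ≥ 0` and
  GATES `γ l h` such that every charged pair has `2l < T`, `l < h ≤ M`, `x ≤ γ ≤ 1`, credit `T ≤ 2l + (h−l)γ`; every low atom `l ≤ M` is shipped
  exactly, `Σ_h w l h (1 − γ l h) = μ l`; every high atom `h ≤ M` (`2h ≥ T`) is loaded by at most its mass, `Σ_l w l h γ l h ≤ μ h`.  THEN `μ` carries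
  a heavy decomposition at `(x, T)` (the pairs, plus the leftover of each high atom as a point).  This is the layer-free twin of typer g22's
  `decAtT_of_flowAtT` (`…QuantLawDecFlowsDecomposition`), in weights rather than flows (no division: `w = f/(1−γ)`).
* **`decAtT_of_pairWeights`** — hence DEC at every layer.

HONEST STATUS.  Tool; `SiblingStep`, `FarTreeRow` OPEN; RATE class (log\*) / honest sentence of `run/shared/lean/prim/quant/README.md` unchanged.
[this work].  Nothing here is cited as a published result.  The gluing rows served [cite: KozmaNitzan2024, Conjecture 3 (p. 15)]; product measure
[cite: Grimmett1999, §1.3 p. 10].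
-/

noncomputable section

open scoped BigOperators

namespace Summit.CriticalPhenomena.PercolationContinuityZ3.Theorems
namespace Quant

open Finset

/-- the two-point law `{lo, hi; g}` (as in `…QuantLawDEC`) -/
local notation3 "TP[" lo ", " hi ", " g ", " h "]" =>
  (g : ℝ) * (if (h : ℕ) = (hi : ℕ) then (1 : ℝ) else 0) + (1 - (g : ℝ)) * (if (h : ℕ) = (lo : ℕ) then (1 : ℝ) else 0)

namespace LawDec

/-- **THE PAIR-WEIGHT FORM OF A HEAVY DECOMPOSITION.**  See the file header. [this work] -/
theorem heavy_of_pairWeights (x T : ℝ) (M : ℕ) (μ : ℕ → ℝ) (w γ : ℕ → ℕ → ℝ) (hx0 : 0 ≤ x) (hx1 : x ≤ 1)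
    (hμM : ∀ h, M < h → μ h = 0) (hμ1 : ∑ h ∈ Finset.range (M + 1), μ h = 1)
    (hw0 : ∀ l h, 0 ≤ w l h)
    (hsupp : ∀ l h, 0 < w l h →
      2 * (l : ℝ) < T ∧ l < h ∧ h ≤ M ∧ x ≤ γ l h ∧ γ l h ≤ 1 ∧ T ≤ 2 * (l : ℝ) + ((h : ℝ) - l) * γ l h)
    (hlow : ∀ l, l ≤ M → 2 * (l : ℝ) < T → ∑ h ∈ Finset.range (M + 1), w l h * (1 - γ l h) = μ l)
    (hcap : ∀ h, h ≤ M → T ≤ 2 * (h : ℝ) → ∑ l ∈ Finset.range (M + 1), w l h * γ l h ≤ μ h) :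
    ∃ (ι : Type) (_ : Fintype ι) (lam g : ι → ℝ) (lo hi : ι → ℕ),
      (∀ i, 0 ≤ lam i) ∧ (∑ i, lam i = 1) ∧ (∀ i, 0 ≤ g i ∧ g i ≤ 1) ∧ (∀ i, lo i ≤ hi i) ∧ (∀ i, hi i ≤ M) ∧
      (∀ h, μ h = ∑ i, lam i * TP[lo i, hi i, g i, h]) ∧
      (∀ i, 0 < lam i → x ≤ g i ∧ T ≤ 2 * (lo i : ℝ) + ((hi i : ℝ) - lo i) * g i) := by
  classical
  -- no weight out of a non-low atom, no weight into a low atom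
  have hw_zero : ∀ l h : ℕ, ¬ (2 * (l : ℝ) < T) → w l h = 0 := by
    intro l h hn
    by_contra hne
    exact hn (hsupp l h (lt_of_le_of_ne (hw0 l h) (Ne.symm hne))).1
  have hin_low : ∀ l t : ℕ, 2 * (t : ℝ) < T → w l t * γ l t = 0 := by
    intro l t ht
    rcases (hw0 l t).eq_or_lt with hz | hp
    · rw [← hz, zero_mul]
    · exfalso
      obtain ⟨_, hlt, _, _, hγ1, hcr⟩ := hsupp l t hp
      have hlt' : (l : ℝ) < t := by exact_mod_cast hlt
      have hd : 0 ≤ (t : ℝ) - l := by linarith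
      have : ((t : ℝ) - l) * γ l t ≤ ((t : ℝ) - l) * 1 := mul_le_mul_of_nonneg_left hγ1 hd
      linarith
  have hout_M : ∀ l h : ℕ, M < h → w l h = 0 := by
    intro l h hM
    by_contra hne
    have := (hsupp l h (lt_of_le_of_ne (hw0 l h) (Ne.symm hne))).2.2.1
    omega
  -- THE MIXTURE IDENTITY, on `ℕ`-indexed sums
  have hlaw : ∀ t : ℕ, μ t
      = (∑ l ∈ Finset.range (M + 1), ∑ h ∈ Finset.range (M + 1),
          w l h * TP[min l h, h, (if 0 < w l h then γ l h else 0), t])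
        + ∑ h ∈ Finset.range (M + 1), (if 2 * (h : ℝ) < T then (0 : ℝ) else
            μ h - ∑ l ∈ Finset.range (M + 1), w l h * γ l h) * TP[h, h, (1 : ℝ), t] := by
    intro t
    have e2 : ∀ l h, w l h * TP[min l h, h, (if 0 < w l h then γ l h else 0), t]
        = (w l h * γ l h) * (if t = h then (1 : ℝ) else 0) + (w l h * (1 - γ l h)) * (if t = l then (1 : ℝ) else 0) := by
      intro l h
      rcases (hw0 l h).eq_or_lt with hz | hp
      · rw [← hz]; simp
      · rw [if_pos hp, min_eq_left (hsupp l h hp).2.1.le]; ring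
    rw [Finset.sum_congr rfl (fun l _ => Finset.sum_congr rfl (fun h _ => e2 l h))]
    simp only [Finset.sum_add_distrib]
    rw [Finset.sum_comm (f := fun l h => (w l h * γ l h) * (if t = h then (1 : ℝ) else 0))]
    simp only [← Finset.sum_mul]
    rw [sum_indicator (fun h => ∑ l ∈ Finset.range (M + 1), w l h * γ l h) (M + 1) t,
      sum_indicator (fun l => ∑ h ∈ Finset.range (M + 1), w l h * (1 - γ l h)) (M + 1) t]
    have e4 : ∀ h : ℕ, (if 2 * (h : ℝ) < T then (0 : ℝ) else μ h - ∑ l ∈ Finset.range (M + 1), w l h * γ l h) * TP[h, h, (1 : ℝ), t]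
        = (if 2 * (h : ℝ) < T then (0 : ℝ) else μ h - ∑ l ∈ Finset.range (M + 1), w l h * γ l h) * (if t = h then (1 : ℝ) else 0) := by
      intro h; ring
    simp only [e4]
    rw [sum_indicator (fun h => if 2 * (h : ℝ) < T then (0 : ℝ) else μ h - ∑ l ∈ Finset.range (M + 1), w l h * γ l h) (M + 1) t]
    by_cases htM : t < M + 1
    · rw [if_pos htM, if_pos htM, if_pos htM]
      by_cases htl : 2 * (t : ℝ) < T
      · -- a low atom: shipped exactly, receives nothing, no point
        have hz : ∑ l ∈ Finset.range (M + 1), w l t * γ l t = 0 := Finset.sum_eq_zero fun l _ => hin_low l t htl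
        rw [if_pos htl, hlow t (by omega) htl, hz]; ring
      · -- a non-low atom: ships nothing
        have hz : ∑ h ∈ Finset.range (M + 1), w t h * (1 - γ t h) = 0 :=
          Finset.sum_eq_zero fun h _ => by rw [hw_zero t h htl, zero_mul]
        rw [if_neg htl, hz]; ring
    · rw [if_neg htM, if_neg htM, if_neg htM, hμM t (by omega)]; ring
  -- THE DECOMPOSITION, indexed by pairs and points
  let ι := (Fin (M + 1) × Fin (M + 1)) ⊕ Fin (M + 1)
  let LAM : ι → ℝ := Sum.elim (fun p : Fin (M + 1) × Fin (M + 1) => w p.1 p.2)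
    (fun h : Fin (M + 1) => if 2 * ((h : ℕ) : ℝ) < T then 0 else μ h - ∑ l ∈ Finset.range (M + 1), w l h * γ l h)
  let G : ι → ℝ := Sum.elim (fun p : Fin (M + 1) × Fin (M + 1) => if 0 < w p.1 p.2 then γ p.1 p.2 else 0) (fun _ => 1)
  let LO : ι → ℕ := Sum.elim (fun p : Fin (M + 1) × Fin (M + 1) => min (p.1 : ℕ) (p.2 : ℕ)) (fun h : Fin (M + 1) => (h : ℕ))
  let HI : ι → ℕ := Sum.elim (fun p : Fin (M + 1) × Fin (M + 1) => ((p.2 : Fin (M + 1)) : ℕ)) (fun h : Fin (M + 1) => (h : ℕ))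
  have hmix : ∀ t : ℕ, μ t = ∑ i : ι, LAM i * TP[LO i, HI i, G i, t] := by
    intro t
    simp only [ι, LAM, G, LO, HI]
    rw [Fintype.sum_sum_type, Fintype.sum_prod_type]
    dsimp only [Sum.elim_inl, Sum.elim_inr]
    refine (hlaw t).trans ?_
    congr 1
    · rw [← Fin.sum_univ_eq_sum_range]
      refine Fintype.sum_congr _ _ (fun l => ?_)
      rw [← Fin.sum_univ_eq_sum_range]
      rfl
    · rw [← Fin.sum_univ_eq_sum_range]
      rfl
  refine ⟨ι, inferInstance, LAM, G, LO, HI, ?_, ?_, ?_, ?_, ?_, hmix, ?_⟩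
  · -- nonnegativity
    rintro (p | h)
    · exact hw0 _ _
    · show 0 ≤ (if 2 * ((h : ℕ) : ℝ) < T then (0 : ℝ) else μ h - ∑ l ∈ Finset.range (M + 1), w l h * γ l h)
      split_ifs with hl
      · exact le_rfl
      · exact sub_nonneg.2 (hcap h (Nat.lt_succ_iff.1 h.isLt) (not_lt.1 hl))
  · -- total weight = mass
    rw [sum_weights_eq_mass M μ LAM G LO HI ?_ ?_ hmix, hμ1]
    · rintro (p | h)
      · exact (min_le_right _ _).trans (Nat.lt_succ_iff.1 p.2.isLt)
      · exact Nat.lt_succ_iff.1 h.isLt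
    · rintro (p | h)
      · exact Nat.lt_succ_iff.1 p.2.isLt
      · exact Nat.lt_succ_iff.1 h.isLt
  · -- gates in [0,1]
    rintro (p | h)
    · show 0 ≤ (if 0 < w p.1 p.2 then γ p.1 p.2 else 0) ∧ (if 0 < w p.1 p.2 then γ p.1 p.2 else 0) ≤ 1
      split_ifs with hp
      · exact ⟨hx0.trans (hsupp _ _ hp).2.2.2.1, (hsupp _ _ hp).2.2.2.2.1⟩
      · exact ⟨le_rfl, zero_le_one⟩
    · exact ⟨zero_le_one, le_rfl⟩
  · rintro (p | h)
    · exact min_le_right _ _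
    · exact le_rfl
  · rintro (p | h)
    · exact Nat.lt_succ_iff.1 p.2.isLt
    · exact Nat.lt_succ_iff.1 h.isLt
  · -- heaviness of the charged components
    rintro (p | h) hpos
    · have hpos' : 0 < w p.1 p.2 := hpos
      obtain ⟨_, hlt, _, hxγ, _, hcr⟩ := hsupp _ _ hpos'
      show x ≤ (if 0 < w p.1 p.2 then γ p.1 p.2 else 0) ∧
        T ≤ 2 * ((min (p.1 : ℕ) (p.2 : ℕ) : ℕ) : ℝ) + ((((p.2 : Fin (M + 1)) : ℕ) : ℝ) - ((min (p.1 : ℕ) (p.2 : ℕ) : ℕ) : ℝ))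
          * (if 0 < w p.1 p.2 then γ p.1 p.2 else 0)
      rw [if_pos hpos', min_eq_left hlt.le]
      exact ⟨hxγ, hcr⟩
    · have hpos' : 0 < (if 2 * ((h : ℕ) : ℝ) < T then (0 : ℝ) else μ h - ∑ l ∈ Finset.range (M + 1), w l h * γ l h) := hpos
      have hnl : ¬ (2 * ((h : ℕ) : ℝ) < T) := by
        intro hl; rw [if_pos hl] at hpos'; exact lt_irrefl _ hpos'
      show x ≤ (1 : ℝ) ∧ T ≤ 2 * (((h : ℕ)) : ℝ) + ((((h : ℕ)) : ℝ) - ((h : ℕ) : ℝ)) * 1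
      refine ⟨hx1, ?_⟩
      rw [sub_self, zero_mul, add_zero]
      exact not_lt.1 hnl

/-- **hence DEC at every layer.** [this work] -/
theorem decAtT_of_pairWeights (x T : ℝ) (M : ℕ) (μ : ℕ → ℝ) (w γ : ℕ → ℕ → ℝ) (hx0 : 0 ≤ x) (hx1 : x ≤ 1)
    (hμM : ∀ h, M < h → μ h = 0) (hμ1 : ∑ h ∈ Finset.range (M + 1), μ h = 1)
    (hw0 : ∀ l h, 0 ≤ w l h)
    (hsupp : ∀ l h, 0 < w l h →
      2 * (l : ℝ) < T ∧ l < h ∧ h ≤ M ∧ x ≤ γ l h ∧ γ l h ≤ 1 ∧ T ≤ 2 * (l : ℝ) + ((h : ℝ) - l) * γ l h)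
    (hlow : ∀ l, l ≤ M → 2 * (l : ℝ) < T → ∑ h ∈ Finset.range (M + 1), w l h * (1 - γ l h) = μ l)
    (hcap : ∀ h, h ≤ M → T ≤ 2 * (h : ℝ) → ∑ l ∈ Finset.range (M + 1), w l h * γ l h ≤ μ h) (j : ℕ) :
    DECAtT x T j M μ :=
  decAtT_of_heavy x T M μ (heavy_of_pairWeights x T M μ w γ hx0 hx1 hμM hμ1 hw0 hsupp hlow hcap) j

end LawDec
end Quant
end Summit.CriticalPhenomena.PercolationContinuityZ3.Theorems
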